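import Mathlib.Analysis.ODE.ExistUnique
import Mathlib.Analysis.Calculus.Deriv.MeanValue
import Mathlib.Analysis.Calculus.FDeriv.Equiv
import Literature.Analysis.ODE.FlowWithin
import HarnessLib

/-!
# Flows of vector fields on a half-space, within the half-space

Trunk: analysis / ODE (serving the collar neighbourhood theorem for compact manifolds with
boundary, `Literature/Topology/FourManifolds/BoundaryFlowout.lean`, fact seat
`provefact-Literature.SPC4.exists_diffeomorph_comp_incl_eq`; the same local analysis is the ODE input
of Milnor's product theorem `Literature.Topology.FourManifolds.Cobordism.Milnor1965_exists_diffeomorph_of_mlineDeriv_eq_one`).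

In Mathlib's formalism a chart of a manifold with boundary takes values in the closed half-space
`{x | 0 ≤ x 0}` and a smooth vector field read in a chart is only `C^∞` *within* the half-space
(`ContDiffOn`; no extension to an open set is available).  Milnor (*Lectures on the h-cobordism
theorem* (1965), proof of Thm. 3.4) and Lee (*Introduction to Smooth Manifolds* (2013), proof of
Thm. 9.24) extend the field across the boundary and integrate; here the field `V` is extended by
the **Lipschitz retraction** `pr` onto the half-space (`V ∘ pr`, Lipschitz but not smooth), which
is enough for Picard–Lindelöf, and smoothness is recovered *within* the half-space from the
variational-equation theorem `Literature.Analysis.ODE.IsFlowWithin.contDiffOn` of `FlowWithin.lean` once the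
solutions are known to stay in the half-space.  Everything is proved; no named facts.

## Contents

* `Literature.ODE.halfSpace ℓ = {x | 0 ≤ ℓ x}` for `ℓ : E →L[ℝ] ℝ`; `Literature.ODE.IsHalfSpaceRetraction ℓ pr`
  (`pr` is `1`-Lipschitz, retracts onto the half-space, and sends the outside to `{ℓ = 0}`);
  `IsHalfSpaceRetraction.lipschitzOnWith_comp` (`V ∘ pr` is Lipschitz on balls centred in the
  half-space).
* Real analysis: `Icc_nonneg_of_hasDerivWithinAt_pos` (a continuous function on `[a, b]`,
  nonnegative at `a`, with positive derivative wherever negative, is nonnegative — "last exit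
  time" argument), `eq_add_of_hasDerivWithinAt_one`, `nonneg_of_hasDerivWithinAt_of_le`.
* `pos_apply_of_fderivWithin_apply_eq_one` — **inward pointing from a level function**: if
  `g ≥ 0` is differentiable within the trace `A` of a ball on the half-space, vanishes on the
  boundary hyperplane, and `dg(V) = 1` on `A`, then `ℓ (V x) > 0` at boundary points of `A`.
* `exists_flow_mem_closedBall` — Mathlib's Picard–Lindelöf flow together with the confinement
  of the solutions to the ball of the hypotheses (part of Mathlib's construction
  `ODE.FunSpace`, not of its exported statements).
* `Literature.ODE.FlowBox pr V p R` and `nonempty_flowBox` — at a point `p` of the half-space, for `V`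
  of class `C¹` within `{ℓ ≥ 0} ∩ B(p, R)`: radii `0 < r < R' < R`, a time `ε > 0` and the local
  flow of `V ∘ pr` on `closedBall p r × [-ε, ε]`, confined to `closedBall p R'`.
* `FlowBox.flow_mem_halfSpace` — **forward invariance**: if `V` points inward on the boundary
  hyperplane, solutions starting in the half-space stay in it on `[0, ε]` (so they solve
  `u' = V u` there, `FlowBox.hasDerivWithinAt_Icc`).
* `FlowBox.level_eq_add` (`g (flow x t) = g x + t`, Milnor's "`f(ψ_y(s)) = s`"),
  `FlowBox.flow_mem_halfSpace_of_neg` (**backward invariance** on `[-g x, 0]` when `g` vanishes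
  on the boundary hyperplane: the solution through `x` reaches the boundary backward exactly at
  time `-g x`), `FlowBox.level_eq_add_of_level`, `FlowBox.flow_neg_level_mem`.
* `FlowBox.contDiffOn_flow` — the flow is `C^n` within `({ℓ ≥ 0} ∩ B(p, r)) × [0, ε]`;
  `FlowBox.contDiffOn_flow_levelDomain` — and within
  `Ω± = {(x, t) | x ∈ {ℓ ≥ 0} ∩ B(p, r), g x < ε, -g x ≤ t ≤ ε}` (`levelDomain`, which has the
  unique differentiability property as the image of a product under the shear `levelShear`,
  `UniqueDiffOn.image`); `FlowBox.contDiffOn_flow_neg_level` — the **retraction to the zero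
  level** `x ↦ flow x (-g x)` is `C^n` within `{ℓ ≥ 0} ∩ B(p, r) ∩ {g < ε}` (Milnor's
  "`h⁻¹(y) = (ψ_y(0), f(y))`" is smooth).

## References

* S. Lang, *Differential and Riemannian Manifolds*, GTM 160, Springer (1995), Ch. IV §1,
  Thm. 1.14, Thm. 1.16 (smooth dependence; here within a convex set via `FlowWithin.lean`).
  [Lang1995]
* J. Milnor, *Lectures on the h-cobordism theorem*, Princeton (1965), proof of Thm. 3.4
  (integral curves from the boundary, `f(ψ_y(s)) = s`, `h⁻¹(y) = (ψ_y(0), f(y))`).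
  [MilnorHCobordism1965]
* J. M. Lee, *Introduction to Smooth Manifolds*, 2nd ed., GTM 218 (2013), Thm. 9.24 (boundary
  flowout theorem) and its proof (inward-pointing fields, invariance). [LeeSmoothManifolds2013]
* M. W. Hirsch, *Differential Topology*, GTM 33 (1976), §6.2 (vector fields on `∂`-manifolds).
  [Hirsch1976]
-/

open Set Metric Filter Topology
open scoped NNReal ContDiff

noncomputable section

namespace Literature.Analysis.ODE

variable {E : Type*} [NormedAddCommGroup E] [NormedSpace ℝ E]

/-! ## Half-spaces and retractions -/

/-- The closed half-space `{x | 0 ≤ ℓ x}` of a continuous linear functional `ℓ` (for the model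
`𝓡∂ m` of manifolds with boundary, `ℓ` is the coordinate `0`). [folklore] -/
def halfSpace (ℓ : E →L[ℝ] ℝ) : Set E := {x | 0 ≤ ℓ x}

variable {ℓ : E →L[ℝ] ℝ}

/-- Membership in the half-space. [folklore] -/
@[simp] theorem mem_halfSpace {x : E} : x ∈ halfSpace ℓ ↔ 0 ≤ ℓ x := Iff.rfl

/-- The half-space is closed. [folklore] -/
theorem isClosed_halfSpace : IsClosed (halfSpace ℓ) :=
  isClosed_le continuous_const ℓ.continuous

/-- The half-space is convex. [folklore] -/
theorem convex_halfSpace : Convex ℝ (halfSpace ℓ) := by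
  simpa [halfSpace] using convex_halfSpace_ge ℓ.isLinear (0 : ℝ)

/-- A **retraction onto the half-space** compatible with `ℓ`: a `1`-Lipschitz map `pr : E → E`
with values in the half-space, fixing it pointwise, and sending the outside onto the boundary
hyperplane `{ℓ = 0}`.  For `E = ℝᵐ`, `ℓ = x₀` this is `x ↦ (max x₀ 0, x₁, …)`, i.e. Mathlib's
`𝓡∂ m ∘ (𝓡∂ m).symm`.  Used to extend a vector field given on the half-space to a Lipschitz
field on the whole space (`V ∘ pr`), so that Picard–Lindelöf applies at boundary points.
[folklore] -/
structure IsHalfSpaceRetraction (ℓ : E →L[ℝ] ℝ) (pr : E → E) : Prop where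
  lipschitz : LipschitzWith 1 pr
  mem : ∀ x, pr x ∈ halfSpace ℓ
  eq_self : ∀ x ∈ halfSpace ℓ, pr x = x
  apply_eq_zero : ∀ x, ℓ x ≤ 0 → ℓ (pr x) = 0

namespace IsHalfSpaceRetraction

variable {pr : E → E} (hpr : IsHalfSpaceRetraction ℓ pr)
include hpr

/-- A retraction onto the half-space is continuous. [folklore] -/
theorem continuous : Continuous pr := hpr.lipschitz.continuous

/-- A retraction onto the half-space does not increase the distance to a point of the
half-space. [folklore] -/
theorem dist_le {p : E} (hp : p ∈ halfSpace ℓ) (x : E) : dist (pr x) p ≤ dist x p := by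
  have h := hpr.lipschitz.dist_le_mul x p
  rwa [hpr.eq_self p hp, NNReal.coe_one, one_mul] at h

/-- A retraction onto the half-space maps balls centred in the half-space into themselves.
[folklore] -/
theorem mapsTo_ball {p : E} (hp : p ∈ halfSpace ℓ) (R : ℝ) :
    MapsTo pr (ball p R) (halfSpace ℓ ∩ ball p R) := fun x hx =>
  ⟨hpr.mem x, mem_ball.2 ((hpr.dist_le hp x).trans_lt (mem_ball.1 hx))⟩

/-- A retraction onto the half-space maps closed balls centred in the half-space into
themselves. [folklore] -/
theorem mapsTo_closedBall {p : E} (hp : p ∈ halfSpace ℓ) (R : ℝ) :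
    MapsTo pr (closedBall p R) (halfSpace ℓ ∩ closedBall p R) := fun x hx =>
  ⟨hpr.mem x, mem_closedBall.2 ((hpr.dist_le hp x).trans (mem_closedBall.1 hx))⟩

/-- Outside the open half-space a retraction lands on the boundary hyperplane. [folklore] -/
theorem apply_eq_zero_of_not_mem {x : E} (hx : x ∉ halfSpace ℓ) : ℓ (pr x) = 0 :=
  hpr.apply_eq_zero x (le_of_lt (not_le.1 (by simpa using hx)))

/-- The Lipschitz extension `V ∘ pr` of a field `V` which is `K`-Lipschitz on the trace of a
ball on the half-space is `K`-Lipschitz on the ball. [folklore] -/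
theorem lipschitzOnWith_comp {V : E → E} {K : ℝ≥0} {p : E} (hp : p ∈ halfSpace ℓ) {R : ℝ}
    (hV : LipschitzOnWith K V (halfSpace ℓ ∩ ball p R)) : LipschitzOnWith K (V ∘ pr) (ball p R) := by
  intro x hx y hy
  refine (hV (hpr.mapsTo_ball hp R hx) (hpr.mapsTo_ball hp R hy)).trans ?_
  have h := hpr.lipschitz x y
  simp only [ENNReal.coe_one, one_mul] at h
  gcongr

end IsHalfSpaceRetraction

/-! ## Two lemmas of real analysis -/

/-- A continuous function on `[a, b]` which is nonnegative at `a` and has a positive derivative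
wherever it is negative stays nonnegative (the argument behind forward invariance of the
half-space: consider the last time at which the function was nonnegative). [folklore] -/
theorem Icc_nonneg_of_hasDerivWithinAt_pos {y d : ℝ → ℝ} {a b : ℝ} (hy : ContinuousOn y (Icc a b))
    (ha : 0 ≤ y a)
    (hd : ∀ t ∈ Ioc a b, y t < 0 → HasDerivWithinAt y (d t) (Icc a b) t ∧ 0 < d t) :
    ∀ t ∈ Icc a b, 0 ≤ y t := by
  intro t₁ ht₁
  by_contra hneg
  push Not at hneg
  set A : Set ℝ := Icc a t₁ ∩ y ⁻¹' Ici 0 with hA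
  have hAc : IsClosed A :=
    (hy.mono (Icc_subset_Icc le_rfl ht₁.2)).preimage_isClosed_of_isClosed isClosed_Icc isClosed_Ici
  have haA : a ∈ A := ⟨left_mem_Icc.2 ht₁.1, ha⟩
  have hAbdd : BddAbove A := ⟨t₁, fun t ht => ht.1.2⟩
  set t₀ := sSup A with ht₀
  have ht₀A : t₀ ∈ A := hAc.csSup_mem ⟨a, haA⟩ hAbdd
  have ht₀1 : t₀ ≤ t₁ := csSup_le ⟨a, haA⟩ fun t ht => ht.1.2
  have ht₀lt : t₀ < t₁ := by
    rcases ht₀1.lt_or_eq with h | h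
    · exact h
    · exact absurd (h ▸ ht₀A.2 : (0 : ℝ) ≤ y t₁) (not_le.2 hneg)
  have hneg' : ∀ t ∈ Ioc t₀ t₁, y t < 0 := by
    intro t ht
    by_contra h
    push Not at h
    have htA : t ∈ A := ⟨⟨ht₀A.1.1.trans ht.1.le, ht.2⟩, h⟩
    exact absurd (le_csSup hAbdd htA) (not_le.2 ht.1)
  have hsub : Icc t₀ t₁ ⊆ Icc a b := Icc_subset_Icc ht₀A.1.1 ht₁.2
  have hmono : StrictMonoOn y (Icc t₀ t₁) := by
    refine strictMonoOn_of_hasDerivWithinAt_pos (f' := d) (convex_Icc _ _) (hy.mono hsub) ?_ ?_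
    · intro t ht
      rw [interior_Icc] at ht ⊢
      have h := (hd t ⟨ht₀A.1.1.trans_lt ht.1, ht.2.le.trans ht₁.2⟩ (hneg' t ⟨ht.1, ht.2.le⟩)).1
      exact (h.mono hsub).mono Ioo_subset_Icc_self
    · intro t ht
      rw [interior_Icc] at ht
      exact (hd t ⟨ht₀A.1.1.trans_lt ht.1, ht.2.le.trans ht₁.2⟩ (hneg' t ⟨ht.1, ht.2.le⟩)).2
  have hlt := hmono (left_mem_Icc.2 ht₀lt.le) (right_mem_Icc.2 ht₀lt.le) ht₀lt
  exact absurd (ht₀A.2.trans_lt hlt) (not_lt.2 hneg.le)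

/-- A function with derivative `1` on `[a, b]` (one-sided at the end points) is `t ↦ y a + (t - a)`.
[folklore] -/
theorem eq_add_of_hasDerivWithinAt_one {y : ℝ → ℝ} {a b : ℝ}
    (hd : ∀ t ∈ Icc a b, HasDerivWithinAt y 1 (Icc a b) t) : ∀ t ∈ Icc a b, y t = y a + (t - a) := by
  have hcont : ContinuousOn y (Icc a b) := fun t ht => (hd t ht).continuousWithinAt
  have hk := constant_of_has_deriv_right_zero (f := fun t => y t - t) (a := a) (b := b)
    (hcont.sub continuousOn_id) ?_
  · intro t ht
    have h : y t - t = y a - a := hk t ht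
    linarith
  · intro t ht
    have h := (hd t (Ico_subset_Icc_self ht)).sub (hasDerivWithinAt_id t (Icc a b))
    rw [sub_self] at h
    exact h.mono_of_mem_nhdsWithin
      (mem_of_superset (Icc_mem_nhdsGE ht.2) (Icc_subset_Icc ht.1 le_rfl))

/-- The right derivative at `0` of a function on `[0, τ]` with a minimum at `0` is nonnegative.
[folklore] -/
theorem nonneg_of_hasDerivWithinAt_of_le {h : ℝ → ℝ} {d τ : ℝ} (hτ : 0 < τ)
    (hd : HasDerivWithinAt h d (Icc 0 τ) 0) (hmin : ∀ t ∈ Icc 0 τ, h 0 ≤ h t) : 0 ≤ d := by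
  have hd' : HasDerivWithinAt h d (Ioc 0 τ) 0 := hd.mono Ioc_subset_Icc_self
  rw [hasDerivWithinAt_iff_tendsto_slope' (by simp), nhdsWithin_Ioc_eq_nhdsGT hτ] at hd'
  refine ge_of_tendsto hd' ?_
  filter_upwards [Ioc_mem_nhdsGT hτ] with t ht
  rw [slope_def_field]
  exact div_nonneg (sub_nonneg.2 (hmin t (Ioc_subset_Icc_self ht))) (by linarith [ht.1])

/-! ## Inward pointing from a level function -/

section Inward

variable {V : E → E} {g : E → ℝ} {g' : E → E →L[ℝ] ℝ} {p : E} {R : ℝ}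

/-- **A field along which a boundary-defining function increases points inward.**  On the trace
`A = {ℓ ≥ 0} ∩ B(p, R)` of a ball on the half-space let `g ≥ 0` be differentiable within `A`
with `g = 0` on the boundary hyperplane, and let `V` satisfy `dg(V) = 1` on `A`.  Then
`ℓ (V x) > 0` at every boundary point `x ∈ A`: the derivative `dg_x` is nonnegative on every
vector pointing (weakly) into the half-space (one-sided difference quotients of `g ≥ 0 = g x`),
so `dg_x (V x) = 1 > 0` forbids `ℓ (V x) ≤ 0`.  (In a boundary chart of a manifold with boundary
this is the statement that a vector field `ξ` with `ξ(f) = 1` for a boundary-defining function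
`f` is inward-pointing; Milnor, *Lectures on the h-cobordism theorem* (1965), proof of Thm. 3.4;
Lee, *Introduction to Smooth Manifolds* (2013), Prop. 5.41 / proof of Thm. 9.24.) [folklore] -/
theorem pos_apply_of_fderivWithin_apply_eq_one
    (hg : ∀ x ∈ halfSpace ℓ ∩ ball p R, HasFDerivWithinAt g (g' x) (halfSpace ℓ ∩ ball p R) x)
    (hg0 : ∀ x ∈ halfSpace ℓ ∩ ball p R, 0 ≤ g x)
    (hgℓ : ∀ x ∈ halfSpace ℓ ∩ ball p R, ℓ x = 0 → g x = 0)
    (hV : ∀ x ∈ halfSpace ℓ ∩ ball p R, g' x (V x) = 1)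
    {x : E} (hx : x ∈ halfSpace ℓ ∩ ball p R) (hxℓ : ℓ x = 0) : 0 < ℓ (V x) := by
  -- the derivative is nonnegative on vectors pointing weakly inward
  have key : ∀ w : E, 0 ≤ ℓ w → 0 ≤ g' x w := by
    intro w hw
    -- a small segment `x + t w`, `t ∈ [0, τ]`, inside `A`
    obtain ⟨τ, hτ, hseg⟩ : ∃ τ > 0, ∀ t ∈ Icc (0 : ℝ) τ, x + t • w ∈ halfSpace ℓ ∩ ball p R := by
      have hxR : ‖x - p‖ < R := by rw [← dist_eq_norm]; exact mem_ball.1 hx.2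
      refine ⟨(R - ‖x - p‖) / (2 * (‖w‖ + 1)), by positivity, fun t ht => ⟨?_, ?_⟩⟩
      · show 0 ≤ ℓ (x + t • w)
        rw [map_add, map_smul, hxℓ, zero_add, smul_eq_mul]
        exact mul_nonneg ht.1 hw
      · rw [mem_ball, dist_eq_norm]
        have h1 : ‖x + t • w - p‖ ≤ ‖x - p‖ + t * ‖w‖ := by
          calc ‖x + t • w - p‖ = ‖(x - p) + t • w‖ := by abel_nf
            _ ≤ ‖x - p‖ + ‖t • w‖ := norm_add_le _ _
            _ = ‖x - p‖ + t * ‖w‖ := by rw [norm_smul, Real.norm_of_nonneg ht.1]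
        have h2 : t * ‖w‖ ≤ (R - ‖x - p‖) / (2 * (‖w‖ + 1)) * (‖w‖ + 1) :=
          mul_le_mul ht.2 (by linarith) (norm_nonneg _) (by positivity)
        have h3 : (R - ‖x - p‖) / (2 * (‖w‖ + 1)) * (‖w‖ + 1) = (R - ‖x - p‖) / 2 := by
          field_simp
        linarith
    -- the composite `t ↦ g (x + t w)` has right derivative `g' x w` at `0` and a minimum there
    have hline : HasDerivWithinAt (fun t : ℝ => x + t • w) w (Icc 0 τ) 0 := by
      simpa using ((hasDerivWithinAt_id (0 : ℝ) (Icc 0 τ)).smul_const w).const_add x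
    have hx0 : x + (0 : ℝ) • w = x := by simp
    have hcomp : HasDerivWithinAt (fun t : ℝ => g (x + t • w)) (g' x w) (Icc 0 τ) 0 := by
      have hgx : HasFDerivWithinAt g (g' x) (halfSpace ℓ ∩ ball p R) (x + (0 : ℝ) • w) := by
        rw [hx0]; exact hg x hx
      exact hgx.comp_hasDerivWithinAt 0 hline fun t ht => hseg t ht
    refine nonneg_of_hasDerivWithinAt_of_le hτ hcomp fun t ht => ?_
    show g (x + (0 : ℝ) • w) ≤ g (x + t • w)
    rw [hx0, hgℓ x hx hxℓ]
    exact hg0 _ (hseg t ht)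
  by_contra hle
  push Not at hle
  have h1 := key (-V x) (by rw [map_neg]; linarith)
  rw [map_neg, hV x hx] at h1
  linarith

end Inward

/-! ## Local flows of the Lipschitz extension, with confinement -/

section PicardLindelof


/-- **Picard–Lindelöf with confinement.**  Mathlib's local flow
(`IsPicardLindelof.exists_forall_mem_closedBall_eq_forall_mem_Icc_hasDerivWithinAt`) together
with the confinement of the solutions to the closed ball `closedBall x₀ a` on which the
hypotheses are made (this is part of Mathlib's construction, `ODE.FunSpace.compProj_mem_closedBall`,
but not of its exported statement). [folklore] -/
theorem exists_flow_mem_closedBall [CompleteSpace E] {f : ℝ → E → E} {tmin tmax : ℝ}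
    {t₀ : Icc tmin tmax} {x₀ : E} {a r L K : ℝ≥0} (hf : IsPicardLindelof f t₀ x₀ a r L K) :
    ∃ α : E → ℝ → E, ∀ x ∈ closedBall x₀ (r : ℝ), α x t₀ = x ∧
      (∀ t ∈ Icc tmin tmax, HasDerivWithinAt (α x) (f t (α x t)) (Icc tmin tmax) t) ∧
      ∀ t, α x t ∈ closedBall x₀ (a : ℝ) := by
  classical
  have H : ∀ x (hx : x ∈ closedBall x₀ (r : ℝ)), ∃ α : _root_.ODE.FunSpace t₀ x₀ r L,
      Function.IsFixedPt (_root_.ODE.FunSpace.next hf hx) α := fun x hx => _root_.ODE.FunSpace.exists_isFixedPt_next hf hx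
  choose α hα using H
  refine ⟨fun x => if hx : x ∈ closedBall x₀ (r : ℝ) then (α x hx).compProj else 0, fun x hx => ?_⟩
  simp only [dif_pos hx]
  refine ⟨?_, fun t ht => ?_, fun t => (α x hx).compProj_mem_closedBall hf.mul_max_le⟩
  · rw [_root_.ODE.FunSpace.compProj_val, ← hα x hx, _root_.ODE.FunSpace.next_apply₀]
  · rw [_root_.ODE.FunSpace.compProj_apply]
    apply _root_.ODE.hasDerivWithinAt_picard_Icc t₀.2 hf.continuousOn_uncurry
      (α x hx |>.continuous_compProj.continuousOn)
      (fun _ ht' ↦ α x hx |>.compProj_mem_closedBall hf.mul_max_le)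
      x ht |>.congr_of_mem _ ht
    intro t' ht'
    nth_rw 1 [← hα x hx]
    rw [_root_.ODE.FunSpace.compProj_of_mem ht', _root_.ODE.FunSpace.next_apply]

end PicardLindelof

/-! ## Flow boxes at points of the half-space -/

/-- A **flow box** of the field `V` (given on the half-space) at a point `p` of the half-space,
inside the ball `B(p, R)`: radii `0 < r < R' < R`, a time `ε > 0`, and a map `flow` such that for
every initial point `x ∈ closedBall p r` the curve `flow x` starts at `x`, solves
`u' = V (pr u)` on `[-ε, ε]` (the Lipschitz extension of `V` by the retraction `pr`), and stays
in `closedBall p R'`. [folklore] -/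
structure FlowBox (pr : E → E) (V : E → E) (p : E) (R : ℝ) where
  /-- The radius of the ball of initial conditions. -/
  r : ℝ
  /-- The time of existence. -/
  ε : ℝ
  /-- The radius of the ball confining the solutions. -/
  R' : ℝ
  /-- The local flow of `V ∘ pr`. -/
  flow : E → ℝ → E
  r_pos : 0 < r
  ε_pos : 0 < ε
  r_lt : r < R'
  R'_lt : R' < R
  flow_zero : ∀ x ∈ closedBall p r, flow x 0 = x
  hasDerivWithinAt : ∀ x ∈ closedBall p r, ∀ t ∈ Icc (-ε) ε,
    HasDerivWithinAt (flow x) (V (pr (flow x t))) (Icc (-ε) ε) t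
  mem_closedBall : ∀ x ∈ closedBall p r, ∀ t ∈ Icc (-ε) ε, flow x t ∈ closedBall p R'

variable {pr : E → E} {V : E → E} {p : E} {R : ℝ}

/-- **Existence of flow boxes.**  If `V` is `C¹` within the trace of the ball `B(p, R)` on the
half-space (`p` in the half-space), then `V ∘ pr` is Lipschitz and bounded on a smaller ball, and
Picard–Lindelöf (with confinement) provides a flow box at `p`. [folklore] -/
theorem nonempty_flowBox [CompleteSpace E] (hpr : IsHalfSpaceRetraction ℓ pr) (hp : p ∈ halfSpace ℓ)
    (hR : 0 < R) (hV : ContDiffOn ℝ 1 V (halfSpace ℓ ∩ ball p R)) : Nonempty (FlowBox pr V p R) := by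
  have hpA : p ∈ halfSpace ℓ ∩ ball p R := ⟨hp, mem_ball_self hR⟩
  have hconv : Convex ℝ (halfSpace ℓ ∩ ball p R) := convex_halfSpace.inter (convex_ball _ _)
  -- Lipschitz constant near `p`
  obtain ⟨K, t, ht, hK⟩ := (hV p hpA).exists_lipschitzOnWith hconv
  obtain ⟨ρ₁, hρ₁, hρ₁t⟩ := Metric.mem_nhdsWithin_iff.1 ht
  -- bound near `p`
  obtain ⟨ρ₂, hρ₂, hρ₂b⟩ : ∃ ρ₂ > 0, ∀ x ∈ halfSpace ℓ ∩ ball p R, dist x p < ρ₂ →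
      dist (V x) (V p) < 1 :=
    Metric.continuousWithinAt_iff.1 (hV.continuousOn p hpA) 1 one_pos
  set R₀ := min (min ρ₁ ρ₂) R with hR₀
  have hR₀pos : 0 < R₀ := lt_min (lt_min hρ₁ hρ₂) hR
  have hR₀R : R₀ ≤ R := min_le_right _ _
  have hsub : halfSpace ℓ ∩ ball p R₀ ⊆ halfSpace ℓ ∩ ball p R := fun x hx =>
    ⟨hx.1, ball_subset_ball hR₀R hx.2⟩
  have hLipV : LipschitzOnWith K V (halfSpace ℓ ∩ ball p R₀) := by
    refine hK.mono fun x hx => hρ₁t ⟨?_, hsub hx⟩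
    exact ball_subset_ball ((min_le_left _ _).trans (min_le_left _ _)) hx.2
  set L : ℝ≥0 := ‖V p‖₊ + 1 with hL
  have hbdV : ∀ x ∈ halfSpace ℓ ∩ ball p R₀, ‖V x‖ ≤ L := by
    intro x hx
    have h := hρ₂b x (hsub hx) (lt_of_lt_of_le (mem_ball.1 hx.2)
      ((min_le_left _ _).trans (min_le_right _ _)))
    rw [dist_eq_norm] at h
    have : ‖V x‖ ≤ ‖V x - V p‖ + ‖V p‖ := norm_le_norm_sub_add _ _
    simp only [hL, NNReal.coe_add, coe_nnnorm, NNReal.coe_one]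
    linarith
  -- the extension `V ∘ pr` on `ball p R₀`
  have hLip : LipschitzOnWith K (V ∘ pr) (ball p R₀) := hpr.lipschitzOnWith_comp hp hLipV
  have hbd : ∀ x ∈ ball p R₀, ‖(V ∘ pr) x‖ ≤ L := fun x hx => hbdV _ (hpr.mapsTo_ball hp R₀ hx)
  -- Picard–Lindelöf data
  let a : ℝ≥0 := ⟨R₀ / 2, by positivity⟩
  let r : ℝ≥0 := ⟨R₀ / 4, by positivity⟩
  have ha : (a : ℝ) = R₀ / 2 := rfl
  have hr : (r : ℝ) = R₀ / 4 := rfl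
  set ε : ℝ := R₀ / 4 / (L + 1) with hε
  have hεpos : 0 < ε := by positivity
  have haR₀ : (a : ℝ) < R₀ := by rw [ha]; linarith
  have hsubball : closedBall p (a : ℝ) ⊆ ball p R₀ := closedBall_subset_ball haR₀
  let t₀ : Icc (-ε) ε := ⟨0, by constructor <;> linarith⟩
  have hPL : IsPicardLindelof (fun _ : ℝ => V ∘ pr) t₀ p a r L K := by
    refine IsPicardLindelof.of_time_independent (fun x hx => hbd x (hsubball hx))
      (hLip.mono hsubball) ?_
    have hmax : max (ε - (t₀ : ℝ)) ((t₀ : ℝ) - -ε) = ε := by simp [t₀]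
    rw [hmax]
    have hL0 : (0 : ℝ) ≤ L := L.2
    have h1 : (L : ℝ) * ε ≤ R₀ / 4 := by
      rw [hε]
      rw [mul_div_assoc']
      rw [div_le_iff₀ (by positivity)]
      nlinarith
    have h2 : (a : ℝ) - r = R₀ / 4 := by rw [ha, hr]; ring
    linarith
  obtain ⟨α, hα⟩ := exists_flow_mem_closedBall hPL
  rw [hr] at hα
  refine ⟨⟨R₀ / 4, ε, R₀ / 2, α, by positivity, hεpos, by linarith, by linarith,
    fun x hx => (hα x hx).1, fun x hx t ht => (hα x hx).2.1 t ht, fun x hx t _ => ?_⟩⟩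
  have h := (hα x hx).2.2 t
  rwa [ha] at h

namespace FlowBox

variable (B : FlowBox pr V p R)

/-- The ball of initial conditions lies in the confining ball, which lies in `B(p, R)`.
[folklore] -/
theorem closedBall_subset : closedBall p B.R' ⊆ ball p R := Metric.closedBall_subset_ball B.R'_lt

/-- Solutions of a flow box are continuous on `[-ε, ε]`. [folklore] -/
theorem continuousOn_flow {x : E} (hx : x ∈ closedBall p B.r) : ContinuousOn (B.flow x) (Icc (-B.ε) B.ε) :=
  fun t ht => (B.hasDerivWithinAt x hx t ht).continuousWithinAt

/-- The derivative of `t ↦ ℓ (flow x t)`. [folklore] -/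
theorem hasDerivWithinAt_apply_flow {x : E} (hx : x ∈ closedBall p B.r) {t : ℝ}
    (ht : t ∈ Icc (-B.ε) B.ε) :
    HasDerivWithinAt (fun s => ℓ (B.flow x s)) (ℓ (V (pr (B.flow x t)))) (Icc (-B.ε) B.ε) t :=
  (ℓ.hasFDerivAt.comp_hasDerivWithinAt t (B.hasDerivWithinAt x hx t ht))

variable (hpr : IsHalfSpaceRetraction ℓ pr) (hp : p ∈ halfSpace ℓ)
  (hin : ∀ x ∈ halfSpace ℓ ∩ ball p R, ℓ x = 0 → 0 < ℓ (V x))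
include hpr hp hin

/-- **Forward invariance of the half-space.**  If `V` points inward along the boundary
hyperplane (`ℓ (V x) > 0` where `ℓ x = 0`), solutions of `u' = V (pr u)` starting in the
half-space stay in it for positive times: at the last time the solution was in the half-space it
would have to leave with `(ℓ ∘ u)' = ℓ (V (pr u)) > 0`. (Lee, *Introduction to Smooth
Manifolds* (2013), proof of Thm. 9.24; Hirsch, *Differential Topology* (1976), §6.2.)
[folklore] -/
theorem flow_mem_halfSpace {x : E} (hx : x ∈ halfSpace ℓ ∩ closedBall p B.r) {t : ℝ}
    (ht : t ∈ Icc 0 B.ε) : B.flow x t ∈ halfSpace ℓ := by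
  have hsub : Icc 0 B.ε ⊆ Icc (-B.ε) B.ε := Icc_subset_Icc (by linarith [B.ε_pos]) le_rfl
  have hcont : ContinuousOn (fun s => ℓ (B.flow x s)) (Icc 0 B.ε) :=
    (ℓ.continuous.comp_continuousOn (B.continuousOn_flow hx.2)).mono hsub
  refine Icc_nonneg_of_hasDerivWithinAt_pos (d := fun s => ℓ (V (pr (B.flow x s)))) hcont ?_ ?_ t ht
  · show 0 ≤ ℓ (B.flow x 0)
    rw [B.flow_zero x hx.2]
    exact hx.1
  · intro s hs hneg
    refine ⟨(B.hasDerivWithinAt_apply_flow hx.2 (hsub (Ioc_subset_Icc_self hs))).mono hsub, ?_⟩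
    have hout : B.flow x s ∉ halfSpace ℓ := fun h => absurd (mem_halfSpace.1 h) (not_le.2 hneg)
    have hmem : pr (B.flow x s) ∈ halfSpace ℓ ∩ ball p R :=
      hpr.mapsTo_ball hp R (B.closedBall_subset
        (B.mem_closedBall x hx.2 s (hsub (Ioc_subset_Icc_self hs))))
    exact hin _ hmem (hpr.apply_eq_zero_of_not_mem hout)

/-- For positive times the solutions of a flow box starting in the half-space lie in the trace
of `B(p, R)` on the half-space. [folklore] -/
theorem flow_mem {x : E} (hx : x ∈ halfSpace ℓ ∩ closedBall p B.r) {t : ℝ} (ht : t ∈ Icc 0 B.ε) :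
    B.flow x t ∈ halfSpace ℓ ∩ ball p R :=
  ⟨B.flow_mem_halfSpace hpr hp hin hx ht, B.closedBall_subset
    (B.mem_closedBall x hx.2 t (Icc_subset_Icc (by linarith [B.ε_pos]) le_rfl ht))⟩

/-- For positive times the solutions of a flow box starting in the half-space solve `u' = V u`
(within `[0, ε]`). [folklore] -/
theorem hasDerivWithinAt_Icc {x : E} (hx : x ∈ halfSpace ℓ ∩ closedBall p B.r) {t : ℝ}
    (ht : t ∈ Icc 0 B.ε) : HasDerivWithinAt (B.flow x) (V (B.flow x t)) (Icc 0 B.ε) t := by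
  have hsub : Icc 0 B.ε ⊆ Icc (-B.ε) B.ε := Icc_subset_Icc (by linarith [B.ε_pos]) le_rfl
  have h := (B.hasDerivWithinAt x hx.2 t (hsub ht)).mono hsub
  rwa [hpr.eq_self _ (B.flow_mem_halfSpace hpr hp hin hx ht)] at h


/-! ### Level functions: `g (flow x t) = g x + t`, backward invariance -/

variable {g : E → ℝ}

omit hp hin in
/-- Along a solution staying in the half-space on an interval `I ⊆ [-ε, ε]`, a function `g` with
`dg(V) = 1` has derivative `1`. [folklore] -/
theorem hasDerivWithinAt_level (hgd : DifferentiableOn ℝ g (halfSpace ℓ ∩ ball p R))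
    (hgV : ∀ x ∈ halfSpace ℓ ∩ ball p R,
      fderivWithin ℝ g (halfSpace ℓ ∩ ball p R) x (V x) = 1)
    {x : E} (hx : x ∈ closedBall p B.r) {I : Set ℝ} (hI : I ⊆ Icc (-B.ε) B.ε)
    (hmem : ∀ s ∈ I, B.flow x s ∈ halfSpace ℓ) {t : ℝ} (ht : t ∈ I) :
    HasDerivWithinAt (fun s => g (B.flow x s)) 1 I t := by
  have hmem' : ∀ s ∈ I, B.flow x s ∈ halfSpace ℓ ∩ ball p R := fun s hs =>
    ⟨hmem s hs, B.closedBall_subset (B.mem_closedBall x hx s (hI hs))⟩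
  have h1 : HasDerivWithinAt (B.flow x) (V (B.flow x t)) I t := by
    have h := (B.hasDerivWithinAt x hx t (hI ht)).mono hI
    rwa [hpr.eq_self _ (hmem t ht)] at h
  have h2 := ((hgd _ (hmem' t ht)).hasFDerivWithinAt).comp_hasDerivWithinAt t h1 hmem'
  rwa [hgV _ (hmem' t ht)] at h2

omit hp hin in
/-- **Level identity.**  Along a solution staying in the half-space on `[c, d] ⊆ [-ε, ε]`,
`g (flow x s) = g (flow x c) + (s - c)` (Milnor 1965, proof of Thm. 3.4: "`f(ψ_y(s)) = s`").
[folklore] -/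
theorem level_eq (hgd : DifferentiableOn ℝ g (halfSpace ℓ ∩ ball p R))
    (hgV : ∀ x ∈ halfSpace ℓ ∩ ball p R,
      fderivWithin ℝ g (halfSpace ℓ ∩ ball p R) x (V x) = 1)
    {x : E} (hx : x ∈ closedBall p B.r) {c d : ℝ} (hcd : Icc c d ⊆ Icc (-B.ε) B.ε)
    (hmem : ∀ s ∈ Icc c d, B.flow x s ∈ halfSpace ℓ) :
    ∀ s ∈ Icc c d, g (B.flow x s) = g (B.flow x c) + (s - c) :=
  eq_add_of_hasDerivWithinAt_one fun _ ht =>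
    B.hasDerivWithinAt_level hpr hgd hgV hx hcd hmem ht

/-- **Level identity, forward**: `g (flow x t) = g x + t` for `t ∈ [0, ε]` and `x` in the
half-space. [folklore] -/
theorem level_eq_add (hgd : DifferentiableOn ℝ g (halfSpace ℓ ∩ ball p R))
    (hgV : ∀ x ∈ halfSpace ℓ ∩ ball p R,
      fderivWithin ℝ g (halfSpace ℓ ∩ ball p R) x (V x) = 1)
    {x : E} (hx : x ∈ halfSpace ℓ ∩ closedBall p B.r) {t : ℝ} (ht : t ∈ Icc 0 B.ε) :
    g (B.flow x t) = g x + t := by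
  have h := B.level_eq hpr hgd hgV hx.2 (c := 0) (d := B.ε)
    (Icc_subset_Icc (by linarith [B.ε_pos]) le_rfl)
    (fun s hs => B.flow_mem_halfSpace hpr hp hin hx hs) t ht
  rwa [B.flow_zero x hx.2, sub_zero] at h

omit hp hin in
/-- **Backward invariance up to the boundary.**  If moreover `g` vanishes on the boundary
hyperplane, a solution issued from a point `x` of the half-space with `g x ≤ ε` stays in the
half-space backward in time on `[-g x, 0]`: the last time `t*` before `0` at which the solution
is outside the half-space satisfies `ℓ (flow x t*) = 0`, hence `g (flow x t*) = 0`, and the level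
identity on `[t*, 0]` gives `t* = -g x`. [folklore] -/
theorem flow_mem_halfSpace_of_neg (hgd : DifferentiableOn ℝ g (halfSpace ℓ ∩ ball p R))
    (hgV : ∀ x ∈ halfSpace ℓ ∩ ball p R,
      fderivWithin ℝ g (halfSpace ℓ ∩ ball p R) x (V x) = 1)
    (hgℓ : ∀ x ∈ halfSpace ℓ ∩ ball p R, ℓ x = 0 → g x = 0)
    {x : E} (hx : x ∈ halfSpace ℓ ∩ closedBall p B.r) (hgx : g x ≤ B.ε) {t : ℝ}
    (ht : t ∈ Icc (-g x) 0) : B.flow x t ∈ halfSpace ℓ := by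
  by_contra hout
  have hεt : -B.ε ≤ t := by linarith [ht.1]
  set A : Set ℝ := {s | s ∈ Icc (-B.ε) 0 ∧ B.flow x s ∉ halfSpace ℓ} with hA
  have htA : t ∈ A := ⟨⟨hεt, ht.2⟩, hout⟩
  have hAne : A.Nonempty := ⟨t, htA⟩
  have hAbdd : BddAbove A := ⟨0, fun s hs => hs.1.2⟩
  set τ := sSup A with hτ
  have htτ : t ≤ τ := le_csSup hAbdd htA
  have hτ0 : τ ≤ 0 := csSup_le hAne fun s hs => hs.1.2
  have hτε : -B.ε ≤ τ := hεt.trans htτ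
  have hτI : τ ∈ Icc (-B.ε) B.ε := ⟨hτε, hτ0.trans B.ε_pos.le⟩
  -- after `τ` the solution is in the half-space
  have hafter : ∀ s ∈ Icc (-B.ε) 0, τ < s → B.flow x s ∈ halfSpace ℓ := by
    intro s hs hτs
    by_contra h
    exact absurd (le_csSup hAbdd ⟨hs, h⟩) (not_le.2 hτs)
  -- continuity of `ℓ ∘ flow x` at `τ` within `[-ε, ε]`
  have hcont : ContinuousWithinAt (fun s => ℓ (B.flow x s)) (Icc (-B.ε) B.ε) τ :=
    (B.hasDerivWithinAt_apply_flow hx.2 hτI).continuousWithinAt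
  -- at `τ` the solution is in the half-space
  have hτS : B.flow x τ ∈ halfSpace ℓ := by
    by_contra h
    have hneg : ℓ (B.flow x τ) < 0 := not_le.1 (fun h' => h (mem_halfSpace.2 h'))
    have hτ0' : τ < 0 := by
      rcases hτ0.lt_or_eq with h0 | h0
      · exact h0
      · exfalso; apply h; rw [h0, B.flow_zero x hx.2]; exact hx.1
    obtain ⟨δ, hδ, hδc⟩ := Metric.continuousWithinAt_iff.1 hcont (-ℓ (B.flow x τ)) (by linarith)
    set u := min (τ + δ / 2) 0 with hu
    have hτu : τ < u := lt_min (by linarith) hτ0'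
    have huI : u ∈ Icc (-B.ε) 0 := ⟨by linarith [min_le_right (τ + δ / 2) 0, hτu.le], min_le_right _ _⟩
    have hdist : dist u τ < δ := by
      rw [dist_eq_norm, Real.norm_of_nonneg (by linarith)]
      linarith [min_le_left (τ + δ / 2) 0]
    have h1 := hδc ⟨huI.1, huI.2.trans B.ε_pos.le⟩ hdist
    rw [Real.dist_eq, abs_lt] at h1
    have hlt : ℓ (B.flow x u) < 0 := by linarith [h1.2]
    exact absurd (mem_halfSpace.1 (hafter u huI hτu)) (not_le.2 hlt)
  -- hence on `[τ, 0]` the solution is in the half-space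
  have hseg : ∀ s ∈ Icc τ 0, B.flow x s ∈ halfSpace ℓ := by
    intro s hs
    rcases hs.1.lt_or_eq with h | h
    · exact hafter s ⟨hτε.trans hs.1, hs.2⟩ h
    · rw [← h]; exact hτS
  -- and `ℓ (flow x τ) = 0`
  have hτℓ : ℓ (B.flow x τ) = 0 := by
    refine le_antisymm ?_ (mem_halfSpace.1 hτS)
    by_contra hpos
    push Not at hpos
    obtain ⟨δ, hδ, hδc⟩ := Metric.continuousWithinAt_iff.1 hcont (ℓ (B.flow x τ)) hpos
    have hτA : τ ∉ A := fun h => h.2 hτS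
    obtain ⟨s, hsA, hs⟩ := exists_lt_of_lt_csSup hAne (show τ - δ < τ by linarith)
    have hsτ : s ≤ τ := le_csSup hAbdd hsA
    have hsτ' : s < τ := lt_of_le_of_ne hsτ (fun h => hτA (h ▸ hsA))
    have hdist : dist s τ < δ := by
      rw [Real.dist_eq, abs_lt]; constructor <;> linarith
    have h1 := hδc ⟨hsA.1.1, hsA.1.2.trans B.ε_pos.le⟩ hdist
    rw [Real.dist_eq, abs_lt] at h1
    have hge : 0 ≤ ℓ (B.flow x s) := by linarith [h1.1]
    exact hsA.2 (mem_halfSpace.2 hge)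
  have hgτ : g (B.flow x τ) = 0 :=
    hgℓ _ ⟨hτS, B.closedBall_subset (B.mem_closedBall x hx.2 τ hτI)⟩ hτℓ
  -- the level identity on `[τ, 0]` forces `τ = -g x`
  have hlevel := B.level_eq hpr hgd hgV hx.2 (c := τ) (d := 0)
    (Icc_subset_Icc hτε B.ε_pos.le) hseg 0 (right_mem_Icc.2 hτ0)
  rw [B.flow_zero x hx.2, hgτ] at hlevel
  have hτg : τ = -g x := by linarith
  have htτ' : t = τ := le_antisymm htτ (by rw [hτg]; exact ht.1)
  exact hout (htτ' ▸ hτS)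

/-- For `t ∈ [-g x, ε]` the solution through `x` stays in the trace of `B(p, R)` on the
half-space. [folklore] -/
theorem flow_mem_of_level (hgd : DifferentiableOn ℝ g (halfSpace ℓ ∩ ball p R))
    (hgV : ∀ x ∈ halfSpace ℓ ∩ ball p R,
      fderivWithin ℝ g (halfSpace ℓ ∩ ball p R) x (V x) = 1)
    (hgℓ : ∀ x ∈ halfSpace ℓ ∩ ball p R, ℓ x = 0 → g x = 0)
    {x : E} (hx : x ∈ halfSpace ℓ ∩ closedBall p B.r) (hgx : g x ≤ B.ε) {t : ℝ}
    (ht : t ∈ Icc (-g x) B.ε) : B.flow x t ∈ halfSpace ℓ ∩ ball p R := by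
  have htI : t ∈ Icc (-B.ε) B.ε := ⟨by linarith [ht.1], ht.2⟩
  refine ⟨?_, B.closedBall_subset (B.mem_closedBall x hx.2 t htI)⟩
  rcases le_or_gt 0 t with h | h
  · exact B.flow_mem_halfSpace hpr hp hin hx ⟨h, ht.2⟩
  · exact B.flow_mem_halfSpace_of_neg hpr hgd hgV hgℓ hx hgx ⟨ht.1, h.le⟩

/-- **Level identity, two-sided**: `g (flow x t) = g x + t` for `t ∈ [-g x, ε]`; in particular
the backward solution reaches the zero level of `g` (the boundary) exactly at time `-g x`.
[folklore] -/
theorem level_eq_add_of_level (hgd : DifferentiableOn ℝ g (halfSpace ℓ ∩ ball p R))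
    (hgV : ∀ x ∈ halfSpace ℓ ∩ ball p R,
      fderivWithin ℝ g (halfSpace ℓ ∩ ball p R) x (V x) = 1)
    (hgℓ : ∀ x ∈ halfSpace ℓ ∩ ball p R, ℓ x = 0 → g x = 0)
    (hg0 : ∀ x ∈ halfSpace ℓ ∩ ball p R, 0 ≤ g x)
    {x : E} (hx : x ∈ halfSpace ℓ ∩ closedBall p B.r) (hgx : g x ≤ B.ε) {t : ℝ}
    (ht : t ∈ Icc (-g x) B.ε) : g (B.flow x t) = g x + t := by
  have hxR : x ∈ halfSpace ℓ ∩ ball p R :=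
    ⟨hx.1, (Metric.closedBall_subset_ball (B.r_lt.trans B.R'_lt)) hx.2⟩
  have hgx0 := hg0 x hxR
  have hsub : Icc (-g x) B.ε ⊆ Icc (-B.ε) B.ε := Icc_subset_Icc (by linarith) le_rfl
  have hmem : ∀ s ∈ Icc (-g x) B.ε, B.flow x s ∈ halfSpace ℓ := fun s hs =>
    (B.flow_mem_of_level hpr hp hin hgd hgV hgℓ hx hgx hs).1
  have h := B.level_eq hpr hgd hgV hx.2 hsub hmem
  have h0 := h 0 ⟨by linarith, B.ε_pos.le⟩
  rw [B.flow_zero x hx.2] at h0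
  have ht' := h t ht
  linarith

/-! ### Smoothness of the flow within the half-space -/

omit hpr hin in
/-- The trace of a ball centred in the half-space on the half-space has the unique
differentiability property (it is convex with nonempty interior). [folklore] -/
theorem _root_.Literature.Analysis.ODE.uniqueDiffOn_halfSpace_inter_ball {ρ : ℝ} (hρ : 0 < ρ) :
    UniqueDiffOn ℝ (halfSpace ℓ ∩ ball p ρ) := by
  refine uniqueDiffOn_convex (convex_halfSpace.inter (convex_ball _ _)) ?_
  rw [interior_inter, isOpen_ball.interior_eq]
  by_cases hℓ : ∃ e : E, ℓ e ≠ 0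
  · obtain ⟨e₀, he₀⟩ := hℓ
    -- a vector on which `ℓ` is positive
    obtain ⟨e, he⟩ : ∃ e : E, 0 < ℓ e := by
      rcases lt_or_gt_of_ne he₀ with h | h
      · exact ⟨-e₀, by rw [map_neg]; linarith⟩
      · exact ⟨e₀, h⟩
    set δ := ρ / (2 * (‖e‖ + 1)) with hδ
    have hδpos : 0 < δ := by positivity
    refine ⟨p + δ • e, ?_, ?_⟩
    · apply interior_mono (show {x : E | 0 < ℓ x} ⊆ halfSpace ℓ from
        fun x hx => mem_halfSpace.2 (le_of_lt hx))
      rw [(isOpen_lt continuous_const ℓ.continuous).interior_eq]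
      show 0 < ℓ (p + δ • e)
      rw [map_add, map_smul, smul_eq_mul]
      exact add_pos_of_nonneg_of_pos (mem_halfSpace.1 hp) (mul_pos hδpos he)
    · rw [mem_ball, dist_eq_norm, add_sub_cancel_left, norm_smul, Real.norm_of_nonneg hδpos.le]
      have h1 : δ * ‖e‖ ≤ δ * (‖e‖ + 1) := by gcongr; linarith
      have h2 : δ * (‖e‖ + 1) = ρ / 2 := by rw [hδ]; field_simp
      linarith
  · push Not at hℓ
    refine ⟨p, ?_, mem_ball_self hρ⟩
    have huniv : halfSpace ℓ = univ := eq_univ_of_forall fun x => by simp [halfSpace, hℓ x]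
    rw [huniv, interior_univ]
    exact mem_univ _

/-- **The forward flow is smooth within the half-space**: if `V` is `C^n` within the trace of
`B(p, R)` on the half-space (`1 ≤ n`), then `(x, t) ↦ flow x t` is `C^n` on
`({ℓ ≥ 0} ∩ B(p, r)) × [0, ε]` (within that set), by the variational-equation theorem
`Literature.Analysis.ODE.IsFlowWithin.contDiffOn` of `FlowWithin.lean` (Lang 1995, IV §1, Thms. 1.14, 1.16;
Hirsch 1976, §6.2 for fields on `∂`-manifolds). [cite: Lang1995, Ch. IV §1, Thm. 1.16] -/
theorem contDiffOn_flow [CompleteSpace E] {n : ℕ∞} (hn : 1 ≤ n)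
    (hV : ContDiffOn ℝ n V (halfSpace ℓ ∩ ball p R)) :
    ContDiffOn ℝ n (fun q : E × ℝ => B.flow q.1 q.2) ((halfSpace ℓ ∩ ball p B.r) ×ˢ Icc 0 B.ε) := by
  have hflow : IsFlowWithin V (halfSpace ℓ ∩ ball p R) B.flow
      ((halfSpace ℓ ∩ ball p B.r) ×ˢ Icc 0 B.ε) := by
    refine ⟨fun q hq => B.flow_zero q.1 (ball_subset_closedBall hq.1.2), fun q hq t ht => ?_,
      fun q hq t ht => ?_⟩
    · have hq' : q.1 ∈ halfSpace ℓ ∩ closedBall p B.r := ⟨hq.1.1, ball_subset_closedBall hq.1.2⟩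
      rw [uIcc_of_le hq.2.1] at ht ⊢
      exact (B.hasDerivWithinAt_Icc hpr hp hin hq' ⟨ht.1, ht.2.trans hq.2.2⟩).mono
        (Icc_subset_Icc le_rfl hq.2.2)
    · have hq' : q.1 ∈ halfSpace ℓ ∩ closedBall p B.r := ⟨hq.1.1, ball_subset_closedBall hq.1.2⟩
      rw [uIcc_of_le hq.2.1] at ht
      exact B.flow_mem hpr hp hin hq' ⟨ht.1, ht.2.trans hq.2.2⟩
  exact hflow.contDiffOn (convex_halfSpace.inter (convex_ball _ _))
    (uniqueDiffOn_halfSpace_inter_ball hp (B.r_pos.trans (B.r_lt.trans B.R'_lt)))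
    ((uniqueDiffOn_halfSpace_inter_ball hp B.r_pos).prod (uniqueDiffOn_Icc B.ε_pos)) hn hV

/-- The straightening map `(x, θ) ↦ (x, -g x + θ (ε + g x))` sending `[0, 1]` onto the time
interval `[-g x, ε]` over `x`. [folklore] -/
def levelShear (x : E × ℝ) : E × ℝ := (x.1, -g x.1 + x.2 * (B.ε + g x.1))

variable (ℓ) in
/-- The domain `Ω± = {(x, t) | x ∈ {ℓ ≥ 0} ∩ B(p, r), g x < ε, -g x ≤ t ≤ ε}` on which the flow is
smooth within, as the image of a product under `levelShear`. [folklore] -/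
def levelDomain : Set (E × ℝ) :=
  B.levelShear (g := g) '' (((halfSpace ℓ ∩ ball p B.r) ∩ {x | g x < B.ε}) ×ˢ Icc (0 : ℝ) 1)

omit hpr hp hin in
/-- Points of `Ω±` have base point in `{ℓ ≥ 0} ∩ B(p, r) ∩ {g < ε}` and time in `[-g x, ε]`
(given `g ≥ 0`). [folklore] -/
theorem mem_levelDomain (hg0 : ∀ x ∈ halfSpace ℓ ∩ ball p R, 0 ≤ g x) {q : E × ℝ}
    (hq : q ∈ B.levelDomain ℓ (g := g)) :
    q.1 ∈ halfSpace ℓ ∩ ball p B.r ∧ g q.1 < B.ε ∧ q.2 ∈ Icc (-g q.1) B.ε := by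
  obtain ⟨⟨x, θ⟩, ⟨⟨hx, hgx⟩, hθ⟩, rfl⟩ := hq
  have hxR : x ∈ halfSpace ℓ ∩ ball p R :=
    ⟨hx.1, ball_subset_ball (B.r_lt.trans B.R'_lt).le hx.2⟩
  have hg := hg0 x hxR
  refine ⟨hx, hgx, ?_, ?_⟩
  · show -g x ≤ -g x + θ * (B.ε + g x)
    nlinarith [hθ.1, B.ε_pos]
  · show -g x + θ * (B.ε + g x) ≤ B.ε
    nlinarith [hθ.2, B.ε_pos]

omit hpr hp hin in
/-- The bottom `(x, -g x)` of the time interval belongs to `Ω±`. [folklore] -/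
theorem mk_neg_mem_levelDomain {x : E} (hx : x ∈ halfSpace ℓ ∩ ball p B.r) (hgx : g x < B.ε) :
    (x, -g x) ∈ B.levelDomain ℓ (g := g) :=
  ⟨(x, 0), ⟨⟨hx, hgx⟩, left_mem_Icc.2 zero_le_one⟩, by simp [levelShear]⟩

omit hpr hp hin in
/-- `Ω±` has the unique differentiability property: it is the image of a set with this property
under a map whose derivative (within) is onto (`UniqueDiffOn.image`). [folklore] -/
theorem uniqueDiffOn_levelDomain (hgd : DifferentiableOn ℝ g (halfSpace ℓ ∩ ball p R))
    (hg0 : ∀ x ∈ halfSpace ℓ ∩ ball p R, 0 ≤ g x) (hp : p ∈ halfSpace ℓ) :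
    UniqueDiffOn ℝ (B.levelDomain ℓ (g := g)) := by
  set A := halfSpace ℓ ∩ ball p R with hA
  set P := ((halfSpace ℓ ∩ ball p B.r) ∩ {x | g x < B.ε}) ×ˢ Icc (0 : ℝ) 1 with hP
  have hsub : (halfSpace ℓ ∩ ball p B.r) ∩ {x | g x < B.ε} ⊆ A := fun x hx =>
    ⟨hx.1.1, ball_subset_ball (B.r_lt.trans B.R'_lt).le hx.1.2⟩
  -- `P` has the unique differentiability property
  have hP1 : UniqueDiffOn ℝ ((halfSpace ℓ ∩ ball p B.r) ∩ {x | g x < B.ε}) := by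
    intro x hx
    have h1 : UniqueDiffWithinAt ℝ (halfSpace ℓ ∩ ball p B.r) x :=
      uniqueDiffOn_halfSpace_inter_ball hp B.r_pos x hx.1
    have hcont : ContinuousWithinAt g (halfSpace ℓ ∩ ball p B.r) x :=
      ((hgd.continuousOn.mono fun y hy => ⟨hy.1, ball_subset_ball (B.r_lt.trans B.R'_lt).le hy.2⟩)
        x hx.1)
    have hnhds : {y | g y < B.ε} ∈ 𝓝[halfSpace ℓ ∩ ball p B.r] x :=
      hcont.preimage_mem_nhdsWithin (isOpen_Iio.mem_nhds hx.2)
    exact (uniqueDiffWithinAt_inter' hnhds).2 h1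
  have hPu : UniqueDiffOn ℝ P := hP1.prod (uniqueDiffOn_Icc zero_lt_one)
  -- the derivative of the shear and its surjectivity
  let g' : E → E →L[ℝ] ℝ := fun x => fderivWithin ℝ g A x
  let D : E × ℝ → (E × ℝ) →L[ℝ] (E × ℝ) := fun q =>
    (ContinuousLinearMap.fst ℝ E ℝ).prod
      (-((g' q.1).comp (ContinuousLinearMap.fst ℝ E ℝ)) +
        (q.2 • ((g' q.1).comp (ContinuousLinearMap.fst ℝ E ℝ)) +
          (B.ε + g q.1) • ContinuousLinearMap.snd ℝ E ℝ))
  have hD : ∀ q ∈ P, HasFDerivWithinAt (B.levelShear (g := g)) (D q) P q := by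
    rintro ⟨x, θ⟩ hq
    have hxA : x ∈ A := hsub hq.1
    have hg1 : HasFDerivWithinAt (fun q : E × ℝ => g q.1) ((g' x).comp (ContinuousLinearMap.fst ℝ E ℝ))
        P (x, θ) :=
      (hgd x hxA).hasFDerivWithinAt.comp (x, θ) hasFDerivWithinAt_fst fun q hq => hsub hq.1
    have hconst : HasFDerivWithinAt (fun q : E × ℝ => B.ε + g q.1)
        ((g' x).comp (ContinuousLinearMap.fst ℝ E ℝ)) P (x, θ) := by
      simpa using hg1.const_add B.ε
    have hmul := (hasFDerivWithinAt_snd (𝕜 := ℝ) (E := E) (F := ℝ) (s := P) (p := (x, θ))).mul hconst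
    have h2 := hg1.neg.add hmul
    exact hasFDerivWithinAt_fst.prodMk h2
  have hDsurj : ∀ q ∈ P, Function.Surjective (D q) := by
    rintro ⟨x, θ⟩ hq ⟨v, s⟩
    have hpos : 0 < B.ε + g x := add_pos_of_pos_of_nonneg B.ε_pos (hg0 x (hsub hq.1))
    refine ⟨(v, (s + g' x v - θ * g' x v) / (B.ε + g x)), ?_⟩
    have hDq : D (x, θ) (v, (s + g' x v - θ * g' x v) / (B.ε + g x)) =
        (v, -(g' x v) + (θ * (g' x v) +
          (B.ε + g x) * ((s + g' x v - θ * g' x v) / (B.ε + g x)))) := rfl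
    rw [hDq, Prod.mk.injEq]
    refine ⟨rfl, ?_⟩
    field_simp
    ring
  exact hPu.image hD fun q hq => (hDsurj q hq).denseRange

/-- **The flow is smooth within the half-space up to the boundary-reaching time**: on
`Ω± = {(x, t) | x ∈ {ℓ ≥ 0} ∩ B(p, r), g x < ε, -g x ≤ t ≤ ε}` the map `(x, t) ↦ flow x t` is
`C^n` (within `Ω±`), again by `Literature.Analysis.ODE.IsFlowWithin.contDiffOn`. [cite: Lang1995, Ch. IV §1, Thm. 1.16] -/
theorem contDiffOn_flow_levelDomain [CompleteSpace E] {n : ℕ∞} (hn : 1 ≤ n)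
    (hV : ContDiffOn ℝ n V (halfSpace ℓ ∩ ball p R))
    (hgd : DifferentiableOn ℝ g (halfSpace ℓ ∩ ball p R))
    (hgV : ∀ x ∈ halfSpace ℓ ∩ ball p R,
      fderivWithin ℝ g (halfSpace ℓ ∩ ball p R) x (V x) = 1)
    (hgℓ : ∀ x ∈ halfSpace ℓ ∩ ball p R, ℓ x = 0 → g x = 0)
    (hg0 : ∀ x ∈ halfSpace ℓ ∩ ball p R, 0 ≤ g x) :
    ContDiffOn ℝ n (fun q : E × ℝ => B.flow q.1 q.2) (B.levelDomain ℓ (g := g)) := by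
  have hflow : IsFlowWithin V (halfSpace ℓ ∩ ball p R) B.flow (B.levelDomain ℓ (g := g)) := by
    refine ⟨fun q hq => B.flow_zero q.1 (ball_subset_closedBall (B.mem_levelDomain hg0 hq).1.2),
      fun q hq t ht => ?_, fun q hq t ht => ?_⟩
    · obtain ⟨hq1, hgq, hq2⟩ := B.mem_levelDomain hg0 hq
      have hq' : q.1 ∈ halfSpace ℓ ∩ closedBall p B.r := ⟨hq1.1, ball_subset_closedBall hq1.2⟩
      have hsub : uIcc 0 q.2 ⊆ Icc (-g q.1) B.ε := by
        rcases le_or_gt 0 q.2 with h | h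
        · rw [uIcc_of_le h]; exact Icc_subset_Icc (by linarith [hg0 q.1 ⟨hq1.1,
            ball_subset_ball (B.r_lt.trans B.R'_lt).le hq1.2⟩]) hq2.2
        · rw [uIcc_of_ge h.le]; exact Icc_subset_Icc hq2.1 B.ε_pos.le
      have hsub' : uIcc 0 q.2 ⊆ Icc (-B.ε) B.ε := hsub.trans (Icc_subset_Icc (by linarith) le_rfl)
      have h := (B.hasDerivWithinAt q.1 hq'.2 t (hsub' ht)).mono hsub'
      rwa [hpr.eq_self _ (B.flow_mem_of_level hpr hp hin hgd hgV hgℓ hq' hgq.le (hsub ht)).1] at h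
    · obtain ⟨hq1, hgq, hq2⟩ := B.mem_levelDomain hg0 hq
      have hq' : q.1 ∈ halfSpace ℓ ∩ closedBall p B.r := ⟨hq1.1, ball_subset_closedBall hq1.2⟩
      have hsub : uIcc 0 q.2 ⊆ Icc (-g q.1) B.ε := by
        rcases le_or_gt 0 q.2 with h | h
        · rw [uIcc_of_le h]; exact Icc_subset_Icc (by linarith [hg0 q.1 ⟨hq1.1,
            ball_subset_ball (B.r_lt.trans B.R'_lt).le hq1.2⟩]) hq2.2
        · rw [uIcc_of_ge h.le]; exact Icc_subset_Icc hq2.1 B.ε_pos.le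
      exact B.flow_mem_of_level hpr hp hin hgd hgV hgℓ hq' hgq.le (hsub ht)
  exact hflow.contDiffOn (convex_halfSpace.inter (convex_ball _ _))
    (uniqueDiffOn_halfSpace_inter_ball hp (B.r_pos.trans (B.r_lt.trans B.R'_lt)))
    (B.uniqueDiffOn_levelDomain hgd hg0 hp) hn hV

/-- **The retraction to the zero level is smooth**: `x ↦ flow x (-g x)` (the point where the
backward solution through `x` reaches `{g = 0}`, i.e. the boundary) is `C^n` within
`{ℓ ≥ 0} ∩ B(p, r) ∩ {g < ε}`. (Milnor 1965, proof of Thm. 3.4: "`h⁻¹(y) = (ψ_y(0), f(y))`".)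
[cite: MilnorHCobordism1965, proof of Thm. 3.4] -/
theorem contDiffOn_flow_neg_level [CompleteSpace E] {n : ℕ∞} (hn : 1 ≤ n)
    (hV : ContDiffOn ℝ n V (halfSpace ℓ ∩ ball p R))
    (hgn : ContDiffOn ℝ n g (halfSpace ℓ ∩ ball p R))
    (hgV : ∀ x ∈ halfSpace ℓ ∩ ball p R,
      fderivWithin ℝ g (halfSpace ℓ ∩ ball p R) x (V x) = 1)
    (hgℓ : ∀ x ∈ halfSpace ℓ ∩ ball p R, ℓ x = 0 → g x = 0)
    (hg0 : ∀ x ∈ halfSpace ℓ ∩ ball p R, 0 ≤ g x) :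
    ContDiffOn ℝ n (fun x => B.flow x (-g x)) ((halfSpace ℓ ∩ ball p B.r) ∩ {x | g x < B.ε}) := by
  have hgd : DifferentiableOn ℝ g (halfSpace ℓ ∩ ball p R) :=
    hgn.differentiableOn (by exact_mod_cast (zero_lt_one.trans_le hn).ne')
  have hsub : (halfSpace ℓ ∩ ball p B.r) ∩ {x | g x < B.ε} ⊆ halfSpace ℓ ∩ ball p R := fun x hx =>
    ⟨hx.1.1, ball_subset_ball (B.r_lt.trans B.R'_lt).le hx.1.2⟩
  have hin' : ContDiffOn ℝ n (fun x : E => (x, -g x)) ((halfSpace ℓ ∩ ball p B.r) ∩ {x | g x < B.ε}) :=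
    contDiffOn_id.prodMk (hgn.mono hsub).neg
  refine (B.contDiffOn_flow_levelDomain hpr hp hin hn hV hgd hgV hgℓ hg0).comp hin' ?_
  intro x hx
  exact B.mk_neg_mem_levelDomain hx.1 hx.2

/-- The retraction to the zero level lands on the zero level of `g`, inside the trace of
`B(p, R)` on the half-space. [folklore] -/
theorem flow_neg_level_mem (hgd : DifferentiableOn ℝ g (halfSpace ℓ ∩ ball p R))
    (hgV : ∀ x ∈ halfSpace ℓ ∩ ball p R,
      fderivWithin ℝ g (halfSpace ℓ ∩ ball p R) x (V x) = 1)
    (hgℓ : ∀ x ∈ halfSpace ℓ ∩ ball p R, ℓ x = 0 → g x = 0)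
    (hg0 : ∀ x ∈ halfSpace ℓ ∩ ball p R, 0 ≤ g x)
    {x : E} (hx : x ∈ halfSpace ℓ ∩ closedBall p B.r) (hgx : g x ≤ B.ε) :
    B.flow x (-g x) ∈ halfSpace ℓ ∩ ball p R ∧ g (B.flow x (-g x)) = 0 := by
  have hxR : x ∈ halfSpace ℓ ∩ ball p R :=
    ⟨hx.1, (Metric.closedBall_subset_ball (B.r_lt.trans B.R'_lt)) hx.2⟩
  have ht : -g x ∈ Icc (-g x) B.ε := ⟨le_rfl, by linarith [hg0 x hxR, B.ε_pos]⟩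
  refine ⟨B.flow_mem_of_level hpr hp hin hgd hgV hgℓ hx hgx ht, ?_⟩
  have h := B.level_eq_add_of_level hpr hp hin hgd hgV hgℓ hg0 hx hgx ht
  linarith

end FlowBox

end Literature.Analysis.ODE
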